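import Literature.NumberTheory.LFunctions.Zhang2022.DetectorRecipeCertificate

/-!
# Zhang (2022), programme F-S3 (cell landau-siegel §E, seat ls-barrier-p6): the LQ certificate format of
# `DetectorRecipeCertificate`, LOCAL version — hypotheses on `[0,1]` only, and the boundary form as a LOWER
# BOUND for `𝔅_R(g)` (no sign condition on it)

Y. Zhang, *Discrete mean estimates and the Landau–Siegel zero*, arXiv:2211.02515v1 [Zhang2022LandauSiegel] —
an unrefereed manuscript under adjudication. **WHAT THIS IS NOT: not a claim about Theorems 1–2 of
arXiv:2211.02515, about Landau–Siegel zeros, or about Parity; nothing here asserts any claim of the manuscript.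
The programme SEARCHES and TYPES; no claim about Landau–Siegel zeros, Theorems 1–2 of arXiv:2211.02515 or a
repaired Margin232 until a kernel theorem says so.**

`Det.formDetPSD_of_certificate` (p468669) takes `k₁₁, k₂₂ : ℝ → ℝ`, `k₁₂ : ℝ → ℂ` differentiable EVERYWHERE on `ℝ`
with globally continuous derivatives, a pointwise condition on `[0,1]` and a SIGNED boundary form, and concludes
`Det.FormDetPSD R`. For the cell's continuum target (E-010(ii) for every sign-admissible `b`, cell notes
barrier/p6/RESONANT-PLANE.md §7 and INBOX 2026-08-27T01:15Z) the natural certificate is the exact clamped-end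
Riccati potential of the recipe, shifted by `δ > 0` past the clamped end: it is real-analytic on a neighbourhood of
`[0,1]` but has a pole at `y = 1 + δ`, and its boundary matrix `H_δ` converges to the decisive matrix `H` only as
`δ → 0` (so `H_δ` need not be positive semidefinite). This file provides the two variants that pipeline needs,
with the SAME proof as p468669 (integration by parts via the right-derivative fundamental theorem of calculus on the
kinked class):

* `formDet_ge_bdForm_of_certificate_on` — if `k₁₁, k₂₂, k₁₂` have derivatives `k′` at every point of `[0,1]`,
  the `k′` are continuous on `[0,1]`, and `certForm R (k(y),k′(y)) (w,v,u) ≥ 0` for `y ∈ [0,1]`, `w,v,u ∈ ℂ`, then for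
  every one-sided kinked `g` (`g(1) = 0`), with `T(0) = ∫₀¹ g`:
  `bdForm R (k₁₁(0), k₂₂(0), k₁₂(0)) (T(0), g(0)) ≤ 𝔅_R(g)` — the boundary form is a lower bound, whatever its sign;
* `formDetPSD_of_certificate_on` — the local version of p468669 (adds the boundary hypothesis, concludes
  `Det.FormDetPSD R`);
* `formDet_nonneg_of_certificate_family` — the limit form used with `δ → 0`: if for every `δ` in a set with `0` as a
  cluster point (a filter `l` with `NeBot`) such a local certificate `k^δ` exists and the boundary forms
  `bdForm R (k^δ(0)) (a, b)` tend to a limit `q(a,b) ≥ 0` for all `a, b`, then `𝔅_R(g) ≥ 0` on the one-sided kinked class.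

Elementary calculus; no numerics inside; standard axioms; no definitions.

References: Y. Zhang, arXiv:2211.02515v1 (2022), Prop. 7.1 with (8.11)–(8.23) [pp. 44–50]; §2 (2.16), Lemma 2.3.
[cite: Zhang2022LandauSiegel, §7 Prop. 7.1, §8 (8.11)–(8.23)]
-/

noncomputable section

open Complex Real ComplexConjugate Set intervalIntegral Filter
open _root_.MeasureTheory
open scoped Topology

namespace Literature.NumberTheory.LFunctions.Zhang2022

namespace Det

open Repair

variable {R : DetRecipe} {g g' : ℝ → ℂ}

/-- `(conj ∘ h)` inherits a right derivative. [folklore] -/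
private theorem hasDerivWithinAt_conj_comp' {h : ℝ → ℂ} {h' : ℂ} {s : Set ℝ} {x : ℝ}
    (hh : HasDerivWithinAt h h' s x) : HasDerivWithinAt (fun x => conj (h x)) (conj h') s x := by
  simpa using hh.star

/-- **The boundary form is a lower bound for `𝔅_R(g)` under a LOCAL pointwise certificate.** Let
`k₁₁, k₂₂ : ℝ → ℝ`, `k₁₂ : ℝ → ℂ` have derivatives `k₁₁′(y), k₂₂′(y), k₁₂′(y)` at every `y ∈ [0,1]`, with `k′`
continuous on `[0,1]`, and suppose `certForm R (k(y), k′(y)) (w, v, u) ≥ 0` for all `y ∈ [0,1]`, `w, v, u ∈ ℂ`. Then for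
every one-sided kinked profile `g` (`g(1) = 0`), writing `T(0) = ∫₀¹ g`,
`bdForm R (k₁₁(0), k₂₂(0), k₁₂(0)) (T(0), g(0)) ≤ 𝔅_R(g)`. Indeed
`𝔅_R(g) = ∫₀¹ certForm(…)(T, g, g′) + bdForm(…)(T(0), g(0))` (`Det.formDet_eq_integral_pointwise` and the fundamental
theorem of calculus for `Φ = k₁₁|T|² + 2Re(k₁₂T̄g) + k₂₂|g|²`, `Φ(1) = 0`).
[cite: Zhang2022LandauSiegel, Prop 7.1 with (8.11)–(8.23), pp.44–50; §2 (2.16)] -/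
theorem formDet_ge_bdForm_of_certificate_on (k11 k22 k11' k22' : ℝ → ℝ) (k12 k12' : ℝ → ℂ)
    (hk11 : ∀ y ∈ Icc (0:ℝ) 1, HasDerivAt k11 (k11' y) y) (hk22 : ∀ y ∈ Icc (0:ℝ) 1, HasDerivAt k22 (k22' y) y)
    (hk12 : ∀ y ∈ Icc (0:ℝ) 1, HasDerivAt k12 (k12' y) y)
    (hc11 : ContinuousOn k11' (Icc 0 1)) (hc22 : ContinuousOn k22' (Icc 0 1))
    (hc12 : ContinuousOn k12' (Icc 0 1))
    (HP : ∀ y ∈ Icc (0:ℝ) 1, ∀ w v u : ℂ,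
      0 ≤ certForm R (k11 y) (k11' y) (k22 y) (k22' y) (k12 y) (k12' y) w v u)
    (hg : KinkedProfile g g') (hg1 : g 1 = 0) :
    bdForm R (k11 0) (k22 0) (k12 0) (∫ t in (0:ℝ)..1, g t) (g 0) ≤ FormDet R g g' := by
  -- continuity of the `k`'s on `[0,1]`
  have ck11 : ContinuousOn k11 (Icc 0 1) := fun y hy => (hk11 y hy).continuousAt.continuousWithinAt
  have ck22 : ContinuousOn k22 (Icc 0 1) := fun y hy => (hk22 y hy).continuousAt.continuousWithinAt
  have ck12 : ContinuousOn k12 (Icc 0 1) := fun y hy => (hk12 y hy).continuousAt.continuousWithinAt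
  -- the tail primitive and its calculus
  set T : ℝ → ℂ := fun y => ∫ t in y..(1:ℝ), g t with hT
  have hTc : ContinuousOn T (Icc 0 1) := continuousOn_tail_unit hg.cont
  have hT1 : T 1 = 0 := by simp [hT]
  have hTd : ∀ x ∈ Ioo (0:ℝ) 1, HasDerivAt T (-g x) x := fun x hx => hasDerivAt_tail_unit hg.cont hx
  -- the potential Φ (complex-valued, real in value) and its right derivative
  set Φ : ℝ → ℂ := fun y => (k11 y : ℂ) * (T y * conj (T y))
      + (k12 y * (conj (T y) * g y) + conj (k12 y * (conj (T y) * g y)))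
      + (k22 y : ℂ) * (g y * conj (g y)) with hΦ
  set dΦ : ℝ → ℂ := fun y => ((k11' y : ℂ) * (T y * conj (T y)) + (k11 y : ℂ) * (-g y * conj (T y) + T y * conj (-g y)))
      + ((k12' y * (conj (T y) * g y) + k12 y * (conj (-g y) * g y + conj (T y) * g' y))
          + conj (k12' y * (conj (T y) * g y) + k12 y * (conj (-g y) * g y + conj (T y) * g' y)))
      + ((k22' y : ℂ) * (g y * conj (g y)) + (k22 y : ℂ) * (g' y * conj (g y) + g y * conj (g' y))) with hdΦ
  have hΦ1 : Φ 1 = 0 := by simp [hΦ, hT1, hg1]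
  have hofR11 : ContinuousOn (fun y => (k11 y : ℂ)) (Icc 0 1) := Complex.continuous_ofReal.comp_continuousOn ck11
  have hofR22 : ContinuousOn (fun y => (k22 y : ℂ)) (Icc 0 1) := Complex.continuous_ofReal.comp_continuousOn ck22
  have hofR11' : ContinuousOn (fun y => (k11' y : ℂ)) (Icc 0 1) :=
    Complex.continuous_ofReal.comp_continuousOn hc11
  have hofR22' : ContinuousOn (fun y => (k22' y : ℂ)) (Icc 0 1) :=
    Complex.continuous_ofReal.comp_continuousOn hc22
  have hΦc : ContinuousOn Φ (Icc 0 1) := by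
    have hgc := hg.cont
    have hTcc := continuousOn_conj_comp hTc
    have hgcc := continuousOn_conj_comp hgc
    refine (((hofR11.mul (hTc.mul hTcc)).add
      (((ck12.mul (hTcc.mul hgc))).add
        (continuousOn_conj_comp (ck12.mul (hTcc.mul hgc))))).add
      (hofR22.mul (hgc.mul hgcc)))
  have hΦd : ∀ x ∈ Ioo (0:ℝ) 1, HasDerivWithinAt Φ (dΦ x) (Ioi x) x := by
    intro x hx
    have hxI : x ∈ Icc (0:ℝ) 1 := Ioo_subset_Icc_self hx
    have dT : HasDerivWithinAt T (-g x) (Ioi x) x := (hTd x hx).hasDerivWithinAt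
    have dTc : HasDerivWithinAt (fun y => conj (T y)) (conj (-g x)) (Ioi x) x := hasDerivWithinAt_conj_comp' dT
    have dg : HasDerivWithinAt g (g' x) (Ioi x) x := hg.hasDeriv x hx
    have dgc : HasDerivWithinAt (fun y => conj (g y)) (conj (g' x)) (Ioi x) x := hasDerivWithinAt_conj_comp' dg
    have d11 : HasDerivWithinAt (fun y => (k11 y : ℂ)) (k11' x) (Ioi x) x :=
      (hk11 x hxI).ofReal_comp.hasDerivWithinAt
    have d22 : HasDerivWithinAt (fun y => (k22 y : ℂ)) (k22' x) (Ioi x) x :=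
      (hk22 x hxI).ofReal_comp.hasDerivWithinAt
    have d12 : HasDerivWithinAt k12 (k12' x) (Ioi x) x := (hk12 x hxI).hasDerivWithinAt
    have t1 := d11.mul (dT.mul dTc)
    have t2a := d12.mul (dTc.mul dg)
    have t2 := t2a.add (hasDerivWithinAt_conj_comp' t2a)
    have t3 := d22.mul (dg.mul dgc)
    exact (t1.add t2).add t3
  -- integrability of dΦ
  have hdΦi : IntervalIntegrable dΦ volume 0 1 := by
    have hgc := hg.cont
    have hTcc := continuousOn_conj_comp hTc
    have hgcc := continuousOn_conj_comp hgc
    have hg'i : IntervalIntegrable g' volume 0 1 := hg.isH1.intervalIntegrable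
    have hg'ci : IntervalIntegrable (fun x => conj (g' x)) volume 0 1 := by
      rw [intervalIntegrable_iff, uIoc_of_le zero_le_one]
      exact hg.isH1.memLp_conj.integrable one_le_two
    have hI : uIcc (0:ℝ) 1 = Icc 0 1 := uIcc_of_le zero_le_one
    -- continuous pieces
    have c1 : ContinuousOn (fun y => (k11' y : ℂ) * (T y * conj (T y))
        + (k11 y : ℂ) * (-g y * conj (T y) + T y * conj (-g y))) (Icc 0 1) :=
      (hofR11'.mul (hTc.mul hTcc)).add
        (hofR11.mul ((hgc.neg.mul hTcc).add (hTc.mul (continuousOn_conj_comp hgc.neg))))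
    have c2 : ContinuousOn (fun y => k12' y * (conj (T y) * g y) + k12 y * (conj (-g y) * g y)) (Icc 0 1) :=
      (hc12.mul (hTcc.mul hgc)).add (ck12.mul ((continuousOn_conj_comp hgc.neg).mul hgc))
    have c3 : ContinuousOn (fun y => k12 y * conj (T y)) (Icc 0 1) := ck12.mul hTcc
    have c4 : ContinuousOn (fun y => (k22' y : ℂ) * (g y * conj (g y))) (Icc 0 1) :=
      hofR22'.mul (hgc.mul hgcc)
    have c5 : ContinuousOn (fun y => (k22 y : ℂ) * conj (g y)) (Icc 0 1) := hofR22.mul hgcc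
    have c6 : ContinuousOn (fun y => (k22 y : ℂ) * g y) (Icc 0 1) := hofR22.mul hgc
    -- pieces with g'
    have p1 : IntervalIntegrable (fun y => k12' y * (conj (T y) * g y) + k12 y * (conj (-g y) * g y)
        + k12 y * conj (T y) * g' y) volume 0 1 :=
      (c2.intervalIntegrable_of_Icc zero_le_one).add (hg'i.continuousOn_mul (by rwa [hI]))
    have p1c : IntervalIntegrable (fun y => conj (k12' y * (conj (T y) * g y) + k12 y * (conj (-g y) * g y)
        + k12 y * conj (T y) * g' y)) volume 0 1 := by
      rw [intervalIntegrable_iff] at p1 ⊢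
      exact (Complex.conjCLE.toContinuousLinearMap).integrable_comp p1
    have p3 : IntervalIntegrable (fun y => (k22' y : ℂ) * (g y * conj (g y))
        + ((k22 y : ℂ) * conj (g y) * g' y + (k22 y : ℂ) * g y * conj (g' y))) volume 0 1 :=
      (c4.intervalIntegrable_of_Icc zero_le_one).add
        ((hg'i.continuousOn_mul (by rwa [hI])).add (hg'ci.continuousOn_mul (by rwa [hI])))
    have := ((c1.intervalIntegrable_of_Icc zero_le_one).add (p1.add p1c)).add p3
    refine this.congr_uIoo fun y _ => ?_
    simp only [hdΦ, map_add, map_mul]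
    ring
  -- FTC: ∫ dΦ = Φ 1 − Φ 0 = −Φ 0
  have ftc : ∫ y in (0:ℝ)..1, dΦ y = Φ 1 - Φ 0 :=
    intervalIntegral.integral_eq_sub_of_hasDeriv_right_of_le zero_le_one hΦc hΦd hdΦi
  -- real parts: (dΦ y).re is the `k`-part of certForm, (Φ 0).re is the `k`-part of bdForm
  have hre : ∀ y, (dΦ y).re
      = certForm R (k11 y) (k11' y) (k22 y) (k22' y) (k12 y) (k12' y) (T y) (g y) (g' y)
          - pwForm R (T y) (g y) (g' y) := by
    intro y
    simp only [hdΦ, certForm, Complex.sq_norm, Complex.normSq_apply, Complex.add_re, Complex.add_im,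
      Complex.mul_re, Complex.mul_im, Complex.conj_re, Complex.conj_im,
      Complex.ofReal_re, Complex.ofReal_im, Complex.neg_re, Complex.neg_im, map_add, map_mul,
      Complex.conj_conj]
    ring
  have hre0 : (Φ 0).re = bdForm R (k11 0) (k22 0) (k12 0) (T 0) (g 0)
      + 2 * π * ((∑ j : Fin 3, R.W j * (R.n j : ℂ)) * (g 0 * conj (T 0))).re := by
    simp only [hΦ, bdForm, Complex.sq_norm, Complex.normSq_apply, Complex.add_re,
      Complex.mul_re, Complex.mul_im, Complex.conj_re, Complex.conj_im,
      Complex.ofReal_re, Complex.ofReal_im, map_mul, Complex.conj_conj]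
    ring
  -- integral of the real part
  have hint_re : ∫ y in (0:ℝ)..1, (dΦ y).re = -(Φ 0).re := by
    have := intervalIntegral.intervalIntegral_re hdΦi
    simp only [RCLike.re_to_complex] at this
    rw [this, ftc, hΦ1, zero_sub, Complex.neg_re]
  have hcert_nonneg : 0 ≤ ∫ y in (0:ℝ)..1,
      certForm R (k11 y) (k11' y) (k22 y) (k22' y) (k12 y) (k12' y) (T y) (g y) (g' y) :=
    intervalIntegral.integral_nonneg zero_le_one fun y hy => HP y hy _ _ _
  have hsplit : (∫ y in (0:ℝ)..1, pwForm R (T y) (g y) (g' y))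
      = (∫ y in (0:ℝ)..1, certForm R (k11 y) (k11' y) (k22 y) (k22' y) (k12 y) (k12' y) (T y) (g y) (g' y))
        - ∫ y in (0:ℝ)..1, (dΦ y).re := by
    have hdre : IntervalIntegrable (fun y => (dΦ y).re) volume 0 1 := ⟨hdΦi.1.re, hdΦi.2.re⟩
    have hpw_eq : (fun y => pwForm R (T y) (g y) (g' y))
        = fun y => certForm R (k11 y) (k11' y) (k22 y) (k22' y) (k12 y) (k12' y) (T y) (g y) (g' y)
            - (dΦ y).re := by
      funext y; rw [hre y]; ring
    -- integrability of pwForm∘(T,g,g'): it is `FormDet`'s integrand; obtain it from `formDet_eq_integral_pointwise`'s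
    -- building blocks via the identity pwForm = certForm − (dΦ).re and the integrability of certForm∘… below.
    -- We use: certForm∘… = pwForm∘… + (dΦ).re with pwForm∘… integrable (as in p468669).
    have hpwi : IntervalIntegrable (fun y => pwForm R (T y) (g y) (g' y)) volume 0 1 := by
      -- the five atoms of pwForm along (T, g, g') are integrable on the kinked class
      have hH := hg.isH1
      have i1 : IntervalIntegrable (fun y => ‖g' y‖ ^ 2) volume 0 1 := hH.intervalIntegrable_sq
      have i2 : IntervalIntegrable (fun y => g' y * conj (g y)) volume 0 1 :=
        IsH1OnUnitInterval.intervalIntegrable_deriv_mul_conj hH hH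
      have i4 : IntervalIntegrable (fun y => g y * conj (g' y)) volume 0 1 := by
        have hch' : IntervalIntegrable (fun x => conj (g' x)) volume 0 1 := by
          rw [intervalIntegrable_iff, uIoc_of_le zero_le_one]
          exact hH.memLp_conj.integrable one_le_two
        exact hch'.continuousOn_mul (by rw [uIcc_of_le zero_le_one]; exact hg.cont)
      have i5 : IntervalIntegrable (fun y => ‖g y‖ ^ 2) volume 0 1 :=
        ((hg.cont.norm).pow 2).intervalIntegrable_of_Icc zero_le_one
      have i7 : IntervalIntegrable (fun y => g y * conj (T y)) volume 0 1 :=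
        (hg.cont.mul (continuousOn_conj_comp hTc)).intervalIntegrable_of_Icc zero_le_one
      have re_of : ∀ {F : ℝ → ℂ}, IntervalIntegrable F volume 0 1 →
          IntervalIntegrable (fun x => (F x).re) volume 0 1 := fun h => ⟨h.1.re, h.2.re⟩
      have j2 : IntervalIntegrable (fun y => ((∑ j : Fin 3, R.W j * (R.s j : ℂ)) * (g' y * conj (g y))).im)
          volume 0 1 :=
        (re_of ((i2.const_mul (∑ j : Fin 3, R.W j * (R.s j : ℂ))).const_mul (-I))).congr_uIoo
          fun y _ => by simp [Complex.mul_re, Complex.mul_im]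
      have j3 : IntervalIntegrable (fun y => ((∑ j : Fin 3, R.W j * (R.b j : ℂ)) * (g y * conj (g' y))).im)
          volume 0 1 :=
        (re_of ((i4.const_mul (∑ j : Fin 3, R.W j * (R.b j : ℂ))).const_mul (-I))).congr_uIoo
          fun y _ => by simp [Complex.mul_re, Complex.mul_im]
      have j5 : IntervalIntegrable (fun y => ((∑ j : Fin 3, R.W j * ((R.b j : ℂ) * (R.n j : ℂ)))
          * (g y * conj (T y))).im) volume 0 1 :=
        (re_of ((i7.const_mul (∑ j : Fin 3, R.W j * ((R.b j : ℂ) * (R.n j : ℂ)))).const_mul (-I))).congr_uIoo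
          fun y _ => by simp [Complex.mul_re, Complex.mul_im]
      exact ((((i1.const_mul _).add (j2.const_mul 2)).sub (j3.const_mul 2)).add (i5.const_mul _)).sub
        (j5.const_mul _)
    have hci : IntervalIntegrable
        (fun y => certForm R (k11 y) (k11' y) (k22 y) (k22' y) (k12 y) (k12' y) (T y) (g y) (g' y))
        volume 0 1 := by
      refine (hpwi.add hdre).congr_uIoo fun y _ => ?_
      show pwForm R (T y) (g y) (g' y) + (dΦ y).re = _
      rw [hre y]; ring
    rw [hpw_eq, intervalIntegral.integral_sub hci hdre]
  -- assemble
  rw [formDet_eq_integral_pointwise hg hg1, hsplit, hint_re, hre0]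
  linarith

/-- **Local version of `Det.formDetPSD_of_certificate`:** with the hypotheses of
`formDet_ge_bdForm_of_certificate_on` and, in addition, `bdForm R (k(0)) (a, b) ≥ 0` for all `a, b ∈ ℂ`,
`Det.FormDetPSD R`. [cite: Zhang2022LandauSiegel, Prop 7.1 with (8.11)–(8.23), pp.44–50; §2 (2.16)] -/
theorem formDetPSD_of_certificate_on (k11 k22 k11' k22' : ℝ → ℝ) (k12 k12' : ℝ → ℂ)
    (hk11 : ∀ y ∈ Icc (0:ℝ) 1, HasDerivAt k11 (k11' y) y) (hk22 : ∀ y ∈ Icc (0:ℝ) 1, HasDerivAt k22 (k22' y) y)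
    (hk12 : ∀ y ∈ Icc (0:ℝ) 1, HasDerivAt k12 (k12' y) y)
    (hc11 : ContinuousOn k11' (Icc 0 1)) (hc22 : ContinuousOn k22' (Icc 0 1))
    (hc12 : ContinuousOn k12' (Icc 0 1))
    (HP : ∀ y ∈ Icc (0:ℝ) 1, ∀ w v u : ℂ,
      0 ≤ certForm R (k11 y) (k11' y) (k22 y) (k22' y) (k12 y) (k12' y) w v u)
    (HB : ∀ a b : ℂ, 0 ≤ bdForm R (k11 0) (k22 0) (k12 0) a b) :
    FormDetPSD R := fun _ _ hg hg1 =>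
  (HB _ _).trans (formDet_ge_bdForm_of_certificate_on k11 k22 k11' k22' k12 k12' hk11 hk22 hk12 hc11 hc22 hc12
    HP hg hg1)

/-- **Limit form (a family of local certificates whose boundary forms converge to a non-negative form).** Let `l`
be a non-trivial filter on an index type `ι` and, for each `i`, let `(k^i, k^i′)` be a local certificate as in
`formDet_ge_bdForm_of_certificate_on` (derivatives on `[0,1]`, continuous `k′`, pointwise `certForm ≥ 0`). If for
all `a, b ∈ ℂ` the boundary forms `bdForm R (k^i(0)) (a,b)` tend along `l` to a limit `q a b ≥ 0`, then `𝔅_R ≥ 0` on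
the one-sided kinked class: `Det.FormDetPSD R`. (Used with the clamped-end Riccati potential shifted past the end
point by `δ → 0⁺`.) [cite: Zhang2022LandauSiegel, Prop 7.1 with (8.11)–(8.23), pp.44–50; §2 (2.16)] -/
theorem formDetPSD_of_certificate_family {ι : Type*} {l : Filter ι} [l.NeBot]
    (k11 k22 k11' k22' : ι → ℝ → ℝ) (k12 k12' : ι → ℝ → ℂ) (q : ℂ → ℂ → ℝ)
    (hk11 : ∀ i, ∀ y ∈ Icc (0:ℝ) 1, HasDerivAt (k11 i) (k11' i y) y)
    (hk22 : ∀ i, ∀ y ∈ Icc (0:ℝ) 1, HasDerivAt (k22 i) (k22' i y) y)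
    (hk12 : ∀ i, ∀ y ∈ Icc (0:ℝ) 1, HasDerivAt (k12 i) (k12' i y) y)
    (hc11 : ∀ i, ContinuousOn (k11' i) (Icc 0 1)) (hc22 : ∀ i, ContinuousOn (k22' i) (Icc 0 1))
    (hc12 : ∀ i, ContinuousOn (k12' i) (Icc 0 1))
    (HP : ∀ i, ∀ y ∈ Icc (0:ℝ) 1, ∀ w v u : ℂ,
      0 ≤ certForm R (k11 i y) (k11' i y) (k22 i y) (k22' i y) (k12 i y) (k12' i y) w v u)
    (Hlim : ∀ a b : ℂ, Tendsto (fun i => bdForm R (k11 i 0) (k22 i 0) (k12 i 0) a b) l (𝓝 (q a b)))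
    (Hq : ∀ a b : ℂ, 0 ≤ q a b) :
    FormDetPSD R := by
  intro g g' hg hg1
  have hev : ∀ i, bdForm R (k11 i 0) (k22 i 0) (k12 i 0) (∫ t in (0:ℝ)..1, g t) (g 0) ≤ FormDet R g g' :=
    fun i => formDet_ge_bdForm_of_certificate_on (k11 i) (k22 i) (k11' i) (k22' i) (k12 i) (k12' i)
      (hk11 i) (hk22 i) (hk12 i) (hc11 i) (hc22 i) (hc12 i) (HP i) hg hg1
  have hle : q (∫ t in (0:ℝ)..1, g t) (g 0) ≤ FormDet R g g' :=
    le_of_tendsto (Hlim _ _) (Filter.Eventually.of_forall hev)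
  exact (Hq _ _).trans hle

end Det

end Literature.NumberTheory.LFunctions.Zhang2022
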